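import Literature.NumberTheory.LFunctions.ZetaZerosShortIntervalsRH
import Literature.NumberTheory.LFunctions.ZetaZerosProofs

/-!
# RiemannHypothesis / UniversalFactor — `NarrowKernelNoGo` (stmt-RiemannHypothesis-2576), line `Sketch`:
stub K2, under RH every window of fixed length eventually carries a zero of `ζ`

`UniversalFactor.stub_narrowShortWindow`: under the Riemann hypothesis, for every fixed `h > 0` there
is `T₂` with `N(t) < N(t + h)` for `t ≥ T₂` (`N = zetaZeroCount`) — the weak, fixed-length form of
the lower half of Goldston–Gonek's theorem (Balazard–de Roton 2008, Prop. 16). It is the mirror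
image, with Selberg's MINORANT `F₋` of `[−h, h]` (bandwidth `Δ`) and crude constants (fixed `Δ`), of
the tree's `Literature.NumberTheory.LFunctions.ShortIntervalsRH.zetaZeroCount_short_interval_le_of_RH`:

* `UniversalFactor.narrowShortWindow_tsum_le_count`: `Σ_ρ m(ρ) F₋(γ_ρ − t) ≤ N(t+h) − N(t−h)`
  (`F₋ ≤ 𝟙_{(−h,h)}` pointwise);
* `UniversalFactor.narrowShortWindow_count_lower`: for `t ≥ 4`, `Δ ≥ 2`, `e^{πΔ} ≤ t`, `0 < h ≤ 1`,
  `(2h − 1/Δ) log(t/2π)/(2π) − 4⌊e^{2πΔ}⌋ − C ≤ N(t+h) − N(t−h)`, from the explicit formula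
  `Literature.NumberTheory.LFunctions.tsum_zeros_shift_eq_explicit` for `F₋(· − t)`: archimedean
  integral `= (2h − 1/Δ) log(t/2) + O(1)`, `F̂₋(0) = 2h − 1/Δ`, polar terms `|F₋(±i/2 − t)| ≤ 1`,
  and the prime sum over `n ≤ e^{2πΔ}` bounded termwise by `4` (`|(log n/π) F̂₋(log n/2π)| ≤ 4`);
* the stub: `h' = min(h,1)/2`, `Δ = max(2, 1/h')`, centre `t + h'`: `N(t+2h') − N(t) → +∞`.

References: M. Balazard, A. de Roton, arXiv:0810.3587, Props. 10–12, 15–16; D. A. Goldston,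
S. M. Gonek, Bull. LMS 39 (2007), 482–486; E. C. Titchmarsh, *The Theory of the Riemann
Zeta-Function* (1986), §9.12, §14.13.
-/

noncomputable section

-- D-0017: `Summit.<S>.<S>.…` is the designed namespace of a single-problem summit.
set_option linter.dupNamespace false

namespace Summit.RiemannHypothesis.RiemannHypothesis.Theorems

open MeasureTheory Set Filter Complex intervalIntegral
open scoped Real Topology FourierTransform
open Literature.NumberTheory.LFunctions
open Literature.Analysis.Fourier Literature.Analysis.SpecialFunctions ArithmeticFunction

/-! ## The zero sum of the minorant is dominated by the zero count -/

/-- **`Σ_ρ m(ρ) F₋(γ_ρ − t) ≤ N(t+h) − N(t−h)`** for Selberg's minorant `F₋` of `[−h, h]`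
(`F₋(γ − t) ≤ 𝟙_{(−h,h)}(γ − t)`, sum over all non-trivial zeros with multiplicity; `0 < h ≤ t`,
so that every zero in the window has positive ordinate). [cite: BalazardDeRoton2008, Prop. 15 (proof)] -/
theorem UniversalFactor.narrowShortWindow_tsum_le_count {Δ t h : ℝ} (hΔ : 0 < Δ) (hh : 0 < h)
    (hht : h ≤ t)
    (hsum : Summable fun ρ : ZetaZeros.riemannZetaNontrivialZeros ↦
      (riemannZetaZeroOrder (ρ : ℂ) : ℝ) * selbergMinorantReal Δ (-h) h ((ρ : ℂ).im - t)) :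
    ∑' ρ : ZetaZeros.riemannZetaNontrivialZeros,
        (riemannZetaZeroOrder (ρ : ℂ) : ℝ) * selbergMinorantReal Δ (-h) h ((ρ : ℂ).im - t) ≤
      (zetaZeroCount (t + h) : ℝ) - zetaZeroCount (t - h) := by
  classical
  set D : Set ℂ := zetaZeroBox 0 (t + h) \ zetaZeroBox 0 (t - h) with hD
  have hDf : D.Finite := (zetaZeroBox_finite 0 (t + h)).subset Set.sdiff_subset
  have hint : ((zetaZeroCount (t + h) : ℤ) - zetaZeroCount (t - h)) = ∑ᶠ ρ ∈ D, riemannZetaZeroOrder ρ :=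
    Montgomery.zetaZeroCount_sub_eq_finsum (by linarith)
  rw [finsum_mem_eq_finite_toFinset_sum _ hDf] at hint
  have hDZ : ∀ ρ ∈ hDf.toFinset, ρ ∈ ZetaZeros.riemannZetaNontrivialZeros := fun ρ hρ ↦
    zetaZeroBox_subset_riemannZetaNontrivialZeros 0 (t + h) ((Set.Finite.mem_toFinset hDf).1 hρ).1
  -- move to the subtype of non-trivial zeros
  set s : Finset ZetaZeros.riemannZetaNontrivialZeros :=
    hDf.toFinset.subtype (· ∈ ZetaZeros.riemannZetaNontrivialZeros) with hs
  have hsumZ : ∑ ρ ∈ hDf.toFinset, (riemannZetaZeroOrder ρ : ℝ) =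
      ∑ x ∈ s, (riemannZetaZeroOrder (x : ℂ) : ℝ) := by
    rw [hs, Finset.sum_subtype_of_mem (fun ρ : ℂ ↦ (riemannZetaZeroOrder ρ : ℝ)) hDZ]
  have hcast : ((zetaZeroCount (t + h) : ℝ) - zetaZeroCount (t - h)) =
      ∑ ρ ∈ hDf.toFinset, (riemannZetaZeroOrder ρ : ℝ) := by
    have := congrArg (fun z : ℤ ↦ (z : ℝ)) hint
    push_cast at this
    exact this
  rw [hcast, hsumZ]
  -- the finitely supported majorant `g = m(ρ) 𝟙_s`
  set g : ZetaZeros.riemannZetaNontrivialZeros → ℝ := fun x ↦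
    if x ∈ s then (riemannZetaZeroOrder (x : ℂ) : ℝ) else 0 with hg
  have hm0 : ∀ x : ZetaZeros.riemannZetaNontrivialZeros, (0 : ℝ) ≤ riemannZetaZeroOrder (x : ℂ) :=
    fun x ↦ by
      exact_mod_cast riemannZetaZeroOrder_nonneg (ZetaZeros.riemannZetaNontrivialZeros.ne_one x.2)
  have hle : ∀ x : ZetaZeros.riemannZetaNontrivialZeros,
      (riemannZetaZeroOrder (x : ℂ) : ℝ) * selbergMinorantReal Δ (-h) h ((x : ℂ).im - t) ≤ g x := by
    intro x
    by_cases hx : x ∈ s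
    · simp only [hg, if_pos hx]
      have h1 : selbergMinorantReal Δ (-h) h ((x : ℂ).im - t) ≤ 1 :=
        (selbergMinorantReal_le_indicator hΔ _ _ _).trans
          (Set.indicator_apply_le' (fun _ ↦ le_rfl) (fun _ ↦ zero_le_one))
      simpa using mul_le_mul_of_nonneg_left h1 (hm0 x)
    · simp only [hg, if_neg hx]
      have hxD : (x : ℂ) ∉ D := by
        intro hxD
        apply hx
        rw [hs, Finset.mem_subtype]
        exact (Set.Finite.mem_toFinset hDf).2 hxD
      have hnot : (x : ℂ).im - t ∉ Ioo (-h) h := by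
        intro hmem
        apply hxD
        have hζ := ZetaZeros.riemannZetaNontrivialZeros.zeta_eq_zero x.2
        have hre0 := ZetaZeros.riemannZetaNontrivialZeros.re_pos x.2
        have hre1 := ZetaZeros.riemannZetaNontrivialZeros.re_lt_one x.2
        have him1 : t - h < (x : ℂ).im := by linarith [hmem.1]
        refine ⟨⟨hζ, hre0.le, hre1.le, by linarith, by linarith [hmem.2]⟩, fun hb ↦ ?_⟩
        linarith [hb.2.2.2.2]
      have h0 : selbergMinorantReal Δ (-h) h ((x : ℂ).im - t) ≤ 0 := by
        have := selbergMinorantReal_le_indicator hΔ (-h) h ((x : ℂ).im - t)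
        rwa [Set.indicator_of_notMem hnot] at this
      exact mul_nonpos_of_nonneg_of_nonpos (hm0 x) h0
  have hgs : ∀ x ∉ s, g x = 0 := fun x hx ↦ if_neg hx
  have hgsum : Summable g := summable_of_ne_finset_zero hgs
  calc ∑' x : ZetaZeros.riemannZetaNontrivialZeros,
        (riemannZetaZeroOrder (x : ℂ) : ℝ) * selbergMinorantReal Δ (-h) h ((x : ℂ).im - t)
      ≤ ∑' x, g x := hsum.tsum_le_tsum hle hgsum
    _ = ∑ x ∈ s, g x := tsum_eq_sum hgs
    _ = ∑ x ∈ s, (riemannZetaZeroOrder (x : ℂ) : ℝ) := Finset.sum_congr rfl fun x hx ↦ if_pos hx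

/-! ## Pieces of the explicit formula for `F₋(· − t)` -/

/-- The polar terms are `≤ 1`: `‖F₋(±i/2 − t)‖ ≤ 1` when `e^{πΔ} ≤ t`, `t ≥ 4`, `Δ ≥ 2`, `h ≤ 1`
(far-field decay `|F₋(z)| ≤ (3/2) e^{2πΔ|Im z|}/(Δ²(−h − Re z)²)`).
[cite: BalazardDeRoton2008, Prop. 15 (proof)] -/
theorem UniversalFactor.narrowShortWindow_polar_le {Δ t h : ℝ} (ht : 4 ≤ t) (hΔ : 2 ≤ Δ)
    (hexp : Real.exp (π * Δ) ≤ t) (hh0 : 0 < h) (hh1 : h ≤ 1) (s : ℝ) (hs : s = 1 ∨ s = -1) :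
    ‖selbergMinorant Δ (-h) h ((s : ℂ) * (I / 2) - t)‖ ≤ 1 := by
  have hΔ0 : 0 < Δ := by linarith
  have hmin : min (-h) h = -h := min_eq_left (by linarith)
  have h1Δ : 1 / Δ ≤ 1 / 2 := by
    rw [div_le_div_iff₀ hΔ0 (by norm_num)]; linarith
  set z : ℂ := (s : ℂ) * (I / 2) - t with hz
  have hzre : z.re = -t := by rcases hs with rfl | rfl <;> simp [hz]
  have hzim : |z.im| = 1 / 2 := by rcases hs with rfl | rfl <;> simp [hz]
  have hcond : z.re ≤ min (-h) h - 1 / Δ := by rw [hzre, hmin]; linarith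
  have hb := norm_selbergMinorant_le_of_re_le (a := -h) (b := h) hΔ0 hcond
  rw [hzim, hmin, hzre] at hb
  refine hb.trans ?_
  have hexp' : Real.exp (2 * π * Δ * (1 / 2)) ≤ t := by
    rw [show 2 * π * Δ * (1 / 2) = π * Δ by ring]; exact hexp
  have htpos : 0 < t := by linarith
  have hpos : 0 < -h - -t := by linarith
  have hth : (3 / 4 * t) ^ 2 ≤ (-h - -t) ^ 2 := by nlinarith
  have hΔ2 : 4 ≤ Δ ^ 2 := by nlinarith
  rw [div_le_one (by positivity)]
  calc 3 / 2 * Real.exp (2 * π * Δ * (1 / 2)) ≤ 3 / 2 * t := by gcongr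
    _ ≤ 4 * (3 / 4 * t) ^ 2 := by nlinarith
    _ ≤ Δ ^ 2 * (3 / 4 * t) ^ 2 := by gcongr
    _ ≤ Δ ^ 2 * (-h - -t) ^ 2 := by gcongr

/-- The `n`-th prime-side term of the explicit formula for `F₋(· − t)` is the real number
`Λ(n) n^{−½} (1/π) F̂₋(log n/2π) cos(t log n)` (`F̂₋` real and even).
[cite: BalazardDeRoton2008, Prop. 15 (proof)] -/
theorem UniversalFactor.narrowShortWindow_primeTerm_eq_ofReal (Δ h t : ℝ) (n : ℕ) :
    ((vonMangoldt n : ℝ) : ℂ) / (Real.sqrt n : ℂ) *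
      ((1 / (2 * π) : ℂ) * (Complex.exp (-(t * Real.log n) * I) *
        𝓕 (fun x : ℝ ↦ selbergMinorant Δ (-h) h x) (Real.log n / (2 * π))
        + Complex.exp ((t * Real.log n) * I) *
          𝓕 (fun x : ℝ ↦ selbergMinorant Δ (-h) h x) (-(Real.log n / (2 * π))))) =
      (((vonMangoldt n : ℝ) / Real.sqrt n * (1 / π *
        (𝓕 (fun x : ℝ ↦ selbergMinorant Δ (-h) h x) (Real.log n / (2 * π))).re *
          Real.cos (t * Real.log n)) : ℝ) : ℂ) := by
  set ξ : ℝ := Real.log n / (2 * π) with hξ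
  set c : ℝ := Real.cos (t * Real.log n) with hc
  have heven : 𝓕 (fun x : ℝ ↦ selbergMinorant Δ (-h) h x) (-ξ) =
      𝓕 (fun x : ℝ ↦ selbergMinorant Δ (-h) h x) ξ :=
    fourier_selbergMinorant_symm_neg Δ h ξ
  have hreal : 𝓕 (fun x : ℝ ↦ selbergMinorant Δ (-h) h x) ξ =
      (((𝓕 (fun x : ℝ ↦ selbergMinorant Δ (-h) h x) ξ).re : ℝ) : ℂ) := by
    apply Complex.ext
    · simp
    · simp [fourier_selbergMinorant_symm_im Δ h ξ]
  set wr : ℝ := (𝓕 (fun x : ℝ ↦ selbergMinorant Δ (-h) h x) ξ).re with hwr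
  rw [heven, hreal]
  have hcos : Complex.exp (-(t * Real.log n) * I) + Complex.exp ((t * Real.log n) * I) = 2 * (c : ℂ) := by
    rw [hc, Complex.ofReal_cos, Complex.two_cos]
    push_cast
    ring_nf
  have hπ : (π : ℂ) ≠ 0 := Complex.ofReal_ne_zero.2 Real.pi_ne_zero
  rw [show Complex.exp (-(t * Real.log n) * I) * (wr : ℂ) + Complex.exp ((t * Real.log n) * I) * (wr : ℂ) =
    (Complex.exp (-(t * Real.log n) * I) + Complex.exp ((t * Real.log n) * I)) * (wr : ℂ) by ring, hcos]
  push_cast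
  field_simp

/-- Each prime-side term is at most `4` in absolute value:
`|Λ(n) n^{−½} (1/π) F̂₋(log n/2π) cos(t log n)| ≤ |(log n/π) F̂₋(log n/2π)| ≤ 4`
(`Λ(n) ≤ log n`, `√n ≥ 1`; `Λ(0) = Λ(1) = 0`). [cite: BalazardDeRoton2008, Prop. 15] -/
theorem UniversalFactor.narrowShortWindow_abs_primeTerm_le {Δ h : ℝ} (hΔ : 0 < Δ) (hh : 0 ≤ h)
    (t : ℝ) (n : ℕ) :
    |(vonMangoldt n : ℝ) / Real.sqrt n * (1 / π *
        (𝓕 (fun x : ℝ ↦ selbergMinorant Δ (-h) h x) (Real.log n / (2 * π))).re *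
          Real.cos (t * Real.log n))| ≤ 4 := by
  rcases Nat.lt_or_ge n 2 with hn2 | hn2
  · interval_cases n
    · simp
    · simp [vonMangoldt_apply_one]
  have h4 := ShortIntervalsRH.abs_log_mul_re_fourier_selbergMinorant_le hΔ hh hn2
  have hlogpos : 0 < Real.log n := Real.log_pos (by exact_mod_cast hn2)
  have hsq1 : 1 ≤ Real.sqrt n := Real.one_le_sqrt.2 (by exact_mod_cast (by omega : 1 ≤ n))
  have hα : (vonMangoldt n : ℝ) / Real.sqrt n ≤ Real.log n :=
    (div_le_self vonMangoldt_nonneg hsq1).trans vonMangoldt_le_log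
  have hcos := Real.abs_cos_le_one (t * Real.log n)
  set wr : ℝ := (𝓕 (fun x : ℝ ↦ selbergMinorant Δ (-h) h x) (Real.log n / (2 * π))).re
  calc |(vonMangoldt n : ℝ) / Real.sqrt n * (1 / π * wr * Real.cos (t * Real.log n))|
      = (vonMangoldt n : ℝ) / Real.sqrt n * (|1 / π * wr| * |Real.cos (t * Real.log n)|) := by
        rw [abs_mul, abs_mul, abs_of_nonneg (div_nonneg vonMangoldt_nonneg (Real.sqrt_nonneg _))]
    _ ≤ Real.log n * (|1 / π * wr| * 1) := by gcongr
    _ = |Real.log n / π * wr| := by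
        rw [abs_mul, abs_mul, abs_of_pos (by positivity : (0 : ℝ) < 1 / π),
          abs_of_pos (by positivity : (0 : ℝ) < Real.log n / π)]
        ring
    _ ≤ 4 := h4

/-! ## The lower bound -/

/-- **Lower bound for the zero count in a short interval, under RH** (the minorant twin of
Balazard–de Roton 2008, Prop. 15, with crude constants): with an absolute constant `C`, for
`t ≥ 4`, `Δ ≥ 2`, `e^{πΔ} ≤ t`, `0 < h ≤ 1`,
`(2h − 1/Δ) log(t/2π)/(2π) − 4⌊e^{2πΔ}⌋ − C ≤ N(t+h) − N(t−h)`.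
[cite: BalazardDeRoton2008, Prop. 15] -/
theorem UniversalFactor.narrowShortWindow_count_lower (hRH : _root_.RiemannHypothesis) :
    ∃ C : ℝ, ∀ t Δ h : ℝ, 4 ≤ t → 2 ≤ Δ → Real.exp (π * Δ) ≤ t → 0 < h → h ≤ 1 →
      (2 * h - 1 / Δ) * Real.log (t / (2 * π)) / (2 * π) - 4 * (⌊Real.exp (2 * π * Δ)⌋₊ : ℝ) - C ≤
        (zetaZeroCount (t + h) : ℝ) - zetaZeroCount (t - h) := by
  obtain ⟨C_E, hCE⟩ := exists_abs_integral_selbergMinorant_reDigammaQuarter_sub_le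
  refine ⟨|C_E| / (2 * π) + 2, fun t Δ h ht hΔ hexp hh0 hh1 ↦ ?_⟩
  have hΔ0 : 0 < Δ := by linarith
  have hΔ1 : 1 ≤ Δ := by linarith
  have hab : -h ≤ h := by linarith
  have htpos : 0 < t := by linarith
  set F : ℂ → ℂ := selbergMinorant Δ (-h) h with hFdef
  obtain ⟨K, hK, hb⟩ := exists_norm_selbergMinorant_le hΔ0 (-h) h
  have hsupp : ∀ ξ : ℝ, Δ ≤ |ξ| → 𝓕 (fun x : ℝ ↦ F x) ξ = 0 := fun ξ hξ ↦
    fourier_selbergMinorant_eq_zero hΔ0 hab hξ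
  have hFreal : ∀ u : ℝ, F ((u : ℝ) : ℂ) = (selbergMinorantReal Δ (-h) h u : ℂ) := fun u ↦
    selbergMinorant_ofReal Δ (-h) h u
  have hAreal := integrable_selbergMinorant_shift_mul_reDigammaQuarter (t := t) hΔ1 ht hh0 hh1
  have hA : Integrable fun u : ℝ ↦ F ((u - t : ℝ) : ℂ) * (reDigammaQuarter u : ℂ) := by
    refine (Complex.ofRealCLM.integrable_comp hAreal).congr (Eventually.of_forall fun u ↦ ?_)
    simp only [Complex.ofRealCLM_apply, Complex.ofReal_mul, hFreal]
  obtain ⟨hZs, hEqn⟩ := tsum_zeros_shift_eq_explicit hRH hΔ0 (differentiable_selbergMinorant Δ (-h) h)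
    hK.le hb hsupp hA
  -- (1) the left-hand side is real and dominated by the zero count
  have hterm : ∀ ρ : ZetaZeros.riemannZetaNontrivialZeros,
      (riemannZetaZeroOrder (ρ : ℂ) : ℂ) * F ((((ρ : ℂ).im - t : ℝ)) : ℂ) =
        (((riemannZetaZeroOrder (ρ : ℂ) : ℝ) * selbergMinorantReal Δ (-h) h ((ρ : ℂ).im - t) : ℝ) : ℂ) := by
    intro ρ; rw [hFreal]; push_cast; ring
  have hZs' : Summable fun ρ : ZetaZeros.riemannZetaNontrivialZeros ↦
      (riemannZetaZeroOrder (ρ : ℂ) : ℝ) * selbergMinorantReal Δ (-h) h ((ρ : ℂ).im - t) := by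
    have h1 : Summable fun ρ : ZetaZeros.riemannZetaNontrivialZeros ↦
        |(riemannZetaZeroOrder (ρ : ℂ) : ℝ) * selbergMinorantReal Δ (-h) h ((ρ : ℂ).im - t)| := by
      refine hZs.congr fun ρ ↦ ?_
      rw [hterm, Complex.norm_real, Real.norm_eq_abs]
    exact h1.of_abs
  set Zr : ℝ := ∑' ρ : ZetaZeros.riemannZetaNontrivialZeros,
    (riemannZetaZeroOrder (ρ : ℂ) : ℝ) * selbergMinorantReal Δ (-h) h ((ρ : ℂ).im - t) with hZr
  have hLHS : ∑' ρ : ZetaZeros.riemannZetaNontrivialZeros,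
      (riemannZetaZeroOrder (ρ : ℂ) : ℂ) * F ((((ρ : ℂ).im - t : ℝ)) : ℂ) = (Zr : ℂ) := by
    rw [hZr, Complex.ofReal_tsum]
    exact tsum_congr hterm
  have hcount := UniversalFactor.narrowShortWindow_tsum_le_count (t := t) hΔ0 hh0 (by linarith) hZs'
  -- (2) the prime side as a real finite sum
  set N : ℕ := ⌊Real.exp (2 * π * Δ)⌋₊ with hN
  set w : ℝ → ℝ := fun ξ ↦ (𝓕 (fun x : ℝ ↦ F x) ξ).re with hw
  set term : ℕ → ℝ := fun n ↦ (vonMangoldt n : ℝ) / Real.sqrt n * (1 / π * w (Real.log n / (2 * π)) *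
    Real.cos (t * Real.log n)) with htermdef
  have hS : ∑' n : ℕ, ((vonMangoldt n : ℝ) : ℂ) / (Real.sqrt n : ℂ) *
      ((1 / (2 * π) : ℂ) * (Complex.exp (-(t * Real.log n) * I) * 𝓕 (fun x : ℝ ↦ F x) (Real.log n / (2 * π))
        + Complex.exp ((t * Real.log n) * I) * 𝓕 (fun x : ℝ ↦ F x) (-(Real.log n / (2 * π))))) =
      ((∑ n ∈ Finset.Ioc 0 N, term n : ℝ) : ℂ) := by
    rw [tsum_eq_sum (s := Finset.Ioc 0 N)]
    · rw [Complex.ofReal_sum]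
      refine Finset.sum_congr rfl fun n _ ↦ ?_
      simp only [htermdef, hw, hFdef]
      exact UniversalFactor.narrowShortWindow_primeTerm_eq_ofReal Δ h t n
    · intro n hn
      rw [Finset.mem_Ioc, not_and_or, not_lt, not_le] at hn
      rcases hn with hn | hn
      · have : n = 0 := by omega
        subst this; simp
      · -- `n > e^{2πΔ}`: both Fourier values vanish
        have hn1 : Real.exp (2 * π * Δ) < n := by
          have := Nat.lt_floor_add_one (Real.exp (2 * π * Δ))
          rw [← hN] at this
          exact this.trans_le (by exact_mod_cast hn)
        have hnpos : (0 : ℝ) < n := (Real.exp_pos _).trans hn1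
        have hξ : Δ ≤ |Real.log n / (2 * π)| := by
          rw [abs_of_pos (div_pos (Real.log_pos (by
            have : (1 : ℝ) < Real.exp (2 * π * Δ) := by
              have : (0:ℝ) < 2 * π * Δ := by positivity
              exact Real.one_lt_exp_iff.2 this
            linarith)) (by positivity))]
          rw [le_div_iff₀ (by positivity), ← Real.log_exp (Δ * (2 * π))]
          refine Real.log_le_log (Real.exp_pos _) ?_
          rw [show Δ * (2 * π) = 2 * π * Δ by ring]; exact hn1.le
        have hξ' : Δ ≤ |-(Real.log n / (2 * π))| := by rwa [abs_neg]
        rw [hsupp _ hξ, hsupp _ hξ']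
        simp
  -- the prime side is at most `4N` in absolute value
  have hpp : |∑ n ∈ Finset.Ioc 0 N, term n| ≤ 4 * (N : ℝ) := by
    refine (Finset.abs_sum_le_sum_abs _ _).trans ?_
    have hle : ∀ n ∈ Finset.Ioc 0 N, |term n| ≤ 4 := fun n _ ↦ by
      simp only [htermdef, hw, hFdef]
      exact UniversalFactor.narrowShortWindow_abs_primeTerm_le hΔ0 hh0.le t n
    calc ∑ n ∈ Finset.Ioc 0 N, |term n| ≤ ∑ n ∈ Finset.Ioc 0 N, (4 : ℝ) := Finset.sum_le_sum hle
      _ = 4 * (N : ℝ) := by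
          rw [Finset.sum_const, Nat.card_Ioc, nsmul_eq_mul, Nat.sub_zero, mul_comm]
  -- (3) the archimedean side is real and bounded below
  have hF0 : 𝓕 (fun x : ℝ ↦ F x) 0 = ((2 * h - 1 / Δ : ℝ) : ℂ) := by
    rw [hFdef, fourier_selbergMinorant_zero hΔ0 hab]
    congr 1; ring
  have hIint : (∫ u : ℝ, F ((u - t : ℝ) : ℂ) * (reDigammaQuarter u : ℂ)) =
      ((∫ u : ℝ, selbergMinorantReal Δ (-h) h (u - t) * reDigammaQuarter u : ℝ) : ℂ) := by
    rw [← integral_complex_ofReal]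
    refine integral_congr_ae (Eventually.of_forall fun u ↦ ?_)
    simp only [hFreal, Complex.ofReal_mul]
  set Ir : ℝ := ∫ u : ℝ, selbergMinorantReal Δ (-h) h (u - t) * reDigammaQuarter u with hIr
  have hIr : (2 * h - 1 / Δ) * Real.log (t / 2) - |C_E| ≤ Ir := by
    have := hCE Δ t h hΔ1 ht hh0 hh1
    have h2 := (abs_le.1 this).1
    linarith [le_abs_self C_E]
  have hArch : ((1 / (2 * π) : ℂ) * (∫ u : ℝ, F ((u - t : ℝ) : ℂ) * (reDigammaQuarter u : ℂ))
      - (1 / (2 * π) : ℂ) * 𝓕 (fun x : ℝ ↦ F x) 0 * (Real.log π : ℂ)) =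
      ((1 / (2 * π) * (Ir - (2 * h - 1 / Δ) * Real.log π) : ℝ) : ℂ) := by
    rw [hIint, hF0]; push_cast; ring
  have hArch_ge : (2 * h - 1 / Δ) * Real.log (t / (2 * π)) / (2 * π) - |C_E| / (2 * π) ≤
      1 / (2 * π) * (Ir - (2 * h - 1 / Δ) * Real.log π) := by
    have hlogsplit : Real.log (t / 2) = Real.log (t / (2 * π)) + Real.log π := by
      rw [← Real.log_mul (by positivity) Real.pi_ne_zero]; congr 1; field_simp
    rw [hlogsplit] at hIr
    calc (2 * h - 1 / Δ) * Real.log (t / (2 * π)) / (2 * π) - |C_E| / (2 * π)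
        = 1 / (2 * π) * ((2 * h - 1 / Δ) * Real.log (t / (2 * π)) - |C_E|) := by ring
      _ ≤ 1 / (2 * π) * (Ir - (2 * h - 1 / Δ) * Real.log π) :=
          mul_le_mul_of_nonneg_left (by linarith) (by positivity)
  -- (4) the polar side
  have hP : -2 ≤ (selbergMinorant Δ (-h) h (I / 2 - t)).re + (selbergMinorant Δ (-h) h (-(I / 2) - t)).re := by
    have h1 := UniversalFactor.narrowShortWindow_polar_le (Δ := Δ) (t := t) ht hΔ hexp hh0 hh1 1 (Or.inl rfl)
    have h2 := UniversalFactor.narrowShortWindow_polar_le (Δ := Δ) (t := t) ht hΔ hexp hh0 hh1 (-1)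
      (Or.inr rfl)
    simp only [Complex.ofReal_one, one_mul, Complex.ofReal_neg, neg_one_mul] at h1 h2
    have h3 := (abs_le.1 (Complex.abs_re_le_norm (selbergMinorant Δ (-h) h (I / 2 - t)))).1
    have h4 := (abs_le.1 (Complex.abs_re_le_norm (selbergMinorant Δ (-h) h (-(I / 2) - t)))).1
    linarith
  -- (5) assemble
  rw [hLHS, hS, hArch] at hEqn
  have hre := congrArg Complex.re hEqn
  simp only [Complex.ofReal_re, Complex.sub_re, Complex.add_re] at hre
  have hpp' := (abs_le.1 hpp).2
  linarith

/-! ## The stub -/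

/-- **Stub K2 (zeta side, RH): every window of fixed length eventually carries a zero.** Under RH,
for every `h > 0` there is `T₂` with `N(t) < N(t + h)` for all `t ≥ T₂` (lower half of
Goldston–Gonek / Balazard–de Roton Prop. 16 with Selberg's minorant, fixed bandwidth).
[cite: BalazardDeRoton2008, Prop. 16] -/
theorem UniversalFactor.stub_narrowShortWindow : _root_.RiemannHypothesis → ∀ h : ℝ, 0 < h →
    ∃ T₂ : ℝ, ∀ t : ℝ, T₂ ≤ t → zetaZeroCount t < zetaZeroCount (t + h) := by
  intro hRH h hh
  obtain ⟨C, hC⟩ := UniversalFactor.narrowShortWindow_count_lower hRH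
  -- the half-width `h' = min(h,1)/2` and the bandwidth `Δ = max(2, 1/h')`
  set h' : ℝ := min h 1 / 2 with hh'def
  have hmin0 : 0 < min h 1 := lt_min hh one_pos
  have hh'0 : 0 < h' := by positivity
  have hh'1 : h' ≤ 1 := by linarith [min_le_right h 1]
  have h2h' : 2 * h' ≤ h := by linarith [min_le_left h 1]
  set Δ : ℝ := max 2 (1 / h') with hΔdef
  have hΔ2 : 2 ≤ Δ := le_max_left _ _
  have hΔ0 : 0 < Δ := by linarith
  have hmain : h' ≤ 2 * h' - 1 / Δ := by
    have h1 : 1 / h' ≤ Δ := le_max_right _ _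
    rw [div_le_iff₀ hh'0] at h1
    have : 1 / Δ ≤ h' := by rw [div_le_iff₀ hΔ0]; linarith
    linarith
  -- the height `T₂`
  set M : ℝ := (4 * (⌊Real.exp (2 * π * Δ)⌋₊ : ℝ) + |C| + 1) * (2 * π) / h' with hMdef
  have hM0 : 0 ≤ M := by positivity
  refine ⟨max (max 4 (Real.exp (π * Δ))) (2 * π * Real.exp M), fun t ht ↦ ?_⟩
  have ht4 : 4 ≤ t := ((le_max_left _ _).trans (le_max_left _ _)).trans ht
  have htexp : Real.exp (π * Δ) ≤ t := ((le_max_right _ _).trans (le_max_left _ _)).trans ht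
  have htM : 2 * π * Real.exp M ≤ t := (le_max_right _ _).trans ht
  -- the lower bound at the centre `t + h'`
  have hlog : M ≤ Real.log ((t + h') / (2 * π)) := by
    rw [Real.le_log_iff_exp_le (by positivity), le_div_iff₀ (by positivity)]
    linarith
  have hkey := hC (t + h') Δ h' (by linarith) hΔ2 (by linarith) hh'0 hh'1
  rw [show t + h' - h' = t by ring] at hkey
  -- the main term beats the constants
  have hlog0 : 0 ≤ Real.log ((t + h') / (2 * π)) := hM0.trans hlog
  have h1 : 4 * (⌊Real.exp (2 * π * Δ)⌋₊ : ℝ) + |C| + 1 ≤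
      (2 * h' - 1 / Δ) * Real.log ((t + h') / (2 * π)) / (2 * π) := by
    rw [le_div_iff₀ (by positivity : (0 : ℝ) < 2 * π)]
    have h2 : (4 * (⌊Real.exp (2 * π * Δ)⌋₊ : ℝ) + |C| + 1) * (2 * π) = h' * M := by
      rw [hMdef]; field_simp
    rw [h2]
    calc h' * M ≤ h' * Real.log ((t + h') / (2 * π)) := mul_le_mul_of_nonneg_left hlog hh'0.le
      _ ≤ (2 * h' - 1 / Δ) * Real.log ((t + h') / (2 * π)) := mul_le_mul_of_nonneg_right hmain hlog0
  have hCabs : C ≤ |C| := le_abs_self C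
  have hlt : (zetaZeroCount t : ℝ) < zetaZeroCount (t + h' + h') := by linarith
  exact (Nat.cast_lt.1 hlt).trans_le (zetaZeroCount_mono (by linarith))

end Summit.RiemannHypothesis.RiemannHypothesis.Theorems
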